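import Summits.CriticalPhenomena.CardyFormulaZ2.Theorems.CardyBoundaryCoulombGasHalfPlaneMarkDensityLawTwoArmPoint
import Summits.CriticalPhenomena.CardyFormulaZ2.Theorems.CardyBoundaryCoulombGasHalfPlaneMarkDensityLawSymmDiffInclusion

/-!
# `HalfPlaneMarkDensityLaw` (crux stmt-CriticalPhenomena-5661), line `Sketch`:
# stub `stub_lisoAnti` — the isolated-arm events are antitone in the radius

For critical bond percolation on `ℤ²` and a boundary vertex `(k,0)` of the lattice half-plane, the
left-isolated arm event `liso k R` (`(k,0)` is joined INSIDE the half-box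
`Λ⁺_R(k) = [k−R, k+R] × [0, R]` to its rim, and no vertex of `[k−R, k−1] × {0}` is joined to `(k,0)`
inside `Λ⁺_R(k)`) and its mirror image `riso k R` are antitone in `R` on lattice configurations
`ω ⊆ E(ℤ²)`: for `R ≤ R'`, `liso k R' ⊆ liso k R` and `riso k R' ⊆ riso k R`.

* ARM clause: an open path inside `Λ⁺_{R'}(k)` from `(k,0)` to the rim of `Λ⁺_{R'}(k)` ends outside
  `Λ⁺_R(k)` when `R < R'`, so the first-exit lemma (`SymmDiff.arm_of_far`) produces an open path
  inside `Λ⁺_R(k)` from `(k,0)` to the rim of `Λ⁺_R(k)`.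
* ISOLATION clause: by monotonicity of open crossing events (`openCrossing_mono`) in the ambient
  set (`Λ⁺_R(k) ⊆ Λ⁺_{R'}(k)`) and in the source set (`[k−R, k−1] ⊆ [k−R', k−1]`, resp.
  `[k+1, k+R] ⊆ [k+1, k+R']`), contrapositively.
-/

noncomputable section

namespace Summit.CriticalPhenomena.CardyFormulaZ2.Cruxes.HalfPlaneMarkDensityLaw.SketchLine

open Literature.Probability.Percolation Literature.Probability.LatticeModels
open MeasureTheory Filter Set SimpleGraph
open scoped Topology
open Summit.CriticalPhenomena.CardyFormulaZ2.Theorems.HalfPlaneMarkDensityLaw.Negative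

namespace TwoArmLower

/-- The half-boxes `Λ⁺_R(k)` are monotone in the radius. [folklore] -/
lemma hbox_mono (k : ℤ) {R R' : ℕ} (hRR' : R ≤ R') : SymmDiff.hbox k R ⊆ SymmDiff.hbox k R' := by
  intro v hv
  simp only [SymmDiff.hbox, mem_setOf_eq] at hv ⊢
  omega

/-- The left excluded segments `[k−R, k−1] × {0}` are monotone in the radius. [folklore] -/
lemma rowIcc_left_mono (k : ℤ) {R R' : ℕ} (hRR' : R ≤ R') :
    rowIcc (k - R) (k - 1) ⊆ rowIcc (k - R') (k - 1) := by
  intro v hv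
  simp only [rowIcc, mem_setOf_eq] at hv ⊢
  omega

/-- The right excluded segments `[k+1, k+R] × {0}` are monotone in the radius. [folklore] -/
lemma rowIcc_right_mono (k : ℤ) {R R' : ℕ} (hRR' : R ≤ R') :
    rowIcc (k + 1) (k + R) ⊆ rowIcc (k + 1) (k + R') := by
  intro v hv
  simp only [rowIcc, mem_setOf_eq] at hv ⊢
  omega

/-- **Arm clause.** On a lattice configuration, an open path inside `Λ⁺_{R'}(k)` from `(k,0)` to
the rim of `Λ⁺_{R'}(k)` yields, for every `R ≤ R'`, an open path inside `Λ⁺_R(k)` from `(k,0)` to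
the rim of `Λ⁺_R(k)` (first exit from the smaller box). [folklore] -/
theorem arm_anti {ω : BondConfig (Site 2)} (hω : ω ⊆ (zdGraph 2).edgeSet) (k : ℤ) {R R' : ℕ}
    (hRR' : R ≤ R')
    (h : ω ∈ openCrossing (SymmDiff.hbox k R') {bpt k} (SymmDiff.hrim k R')) :
    ω ∈ openCrossing (SymmDiff.hbox k R) {bpt k} (SymmDiff.hrim k R) := by
  rcases hRR'.eq_or_lt with rfl | hlt
  · exact h
  obtain ⟨x, hx, w, hw, hxw⟩ := h
  obtain rfl : x = bpt k := hx
  refine SymmDiff.arm_of_far hω (w := w) ?_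
    (openConnIn_mono (SymmDiff.hbox_subset_halfPlane k R') _ _ hxw)
  intro hwR
  simp only [SymmDiff.hbox, SymmDiff.hrim, mem_setOf_eq] at hw hwR
  omega

/-- **Antitonicity of the isolated-arm events** `SymmDiff.iso k R B_R` in the radius, for a family of
excluded sets `B_R` monotone in `R`. [folklore] -/
theorem iso_anti {ω : BondConfig (Site 2)} (hω : ω ⊆ (zdGraph 2).edgeSet) (k : ℤ) {R R' : ℕ}
    (hRR' : R ≤ R') {B B' : Set (Site 2)} (hBB' : B ⊆ B') (h : ω ∈ SymmDiff.iso k R' B') :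
    ω ∈ SymmDiff.iso k R B :=
  ⟨arm_anti hω k hRR' h.1,
    fun h' ↦ h.2 (openCrossing_mono (hbox_mono k hRR') hBB' subset_rfl h')⟩

/-- STUB 1: antitonicity of the isolated-arm events in the radius, on lattice configurations:
for `R ≤ R'` and `ω ⊆ E(ℤ²)`, `ω ∈ liso k R' → ω ∈ liso k R` and `ω ∈ riso k R' → ω ∈ riso k R`.
[folklore] -/
theorem stub_lisoAnti :
    ∀ (k : ℤ) (R R' : ℕ), R ≤ R' → ∀ ω : BondConfig (Site 2), ω ⊆ (zdGraph 2).edgeSet →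
      (ω ∈ openCrossing {v : Site 2 | 0 ≤ v 1 ∧ v 1 ≤ (R' : ℤ) ∧ k - R' ≤ v 0 ∧ v 0 ≤ k + R'} {bpt k}
              {v : Site 2 | v 0 = k - R' ∨ v 0 = k + R' ∨ v 1 = (R' : ℤ)} \
            openCrossing {v : Site 2 | 0 ≤ v 1 ∧ v 1 ≤ (R' : ℤ) ∧ k - R' ≤ v 0 ∧ v 0 ≤ k + R'}
              (rowIcc (k - R') (k - 1)) {bpt k} →
        ω ∈ openCrossing {v : Site 2 | 0 ≤ v 1 ∧ v 1 ≤ (R : ℤ) ∧ k - R ≤ v 0 ∧ v 0 ≤ k + R} {bpt k}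
              {v : Site 2 | v 0 = k - R ∨ v 0 = k + R ∨ v 1 = (R : ℤ)} \
            openCrossing {v : Site 2 | 0 ≤ v 1 ∧ v 1 ≤ (R : ℤ) ∧ k - R ≤ v 0 ∧ v 0 ≤ k + R}
              (rowIcc (k - R) (k - 1)) {bpt k}) ∧
      (ω ∈ openCrossing {v : Site 2 | 0 ≤ v 1 ∧ v 1 ≤ (R' : ℤ) ∧ k - R' ≤ v 0 ∧ v 0 ≤ k + R'} {bpt k}
              {v : Site 2 | v 0 = k - R' ∨ v 0 = k + R' ∨ v 1 = (R' : ℤ)} \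
            openCrossing {v : Site 2 | 0 ≤ v 1 ∧ v 1 ≤ (R' : ℤ) ∧ k - R' ≤ v 0 ∧ v 0 ≤ k + R'}
              (rowIcc (k + 1) (k + R')) {bpt k} →
        ω ∈ openCrossing {v : Site 2 | 0 ≤ v 1 ∧ v 1 ≤ (R : ℤ) ∧ k - R ≤ v 0 ∧ v 0 ≤ k + R} {bpt k}
              {v : Site 2 | v 0 = k - R ∨ v 0 = k + R ∨ v 1 = (R : ℤ)} \
            openCrossing {v : Site 2 | 0 ≤ v 1 ∧ v 1 ≤ (R : ℤ) ∧ k - R ≤ v 0 ∧ v 0 ≤ k + R}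
              (rowIcc (k + 1) (k + R)) {bpt k}) := by
  intro k R R' hRR' ω hω
  show (ω ∈ SymmDiff.iso k R' (rowIcc (k - R') (k - 1)) → ω ∈ SymmDiff.iso k R (rowIcc (k - R) (k - 1))) ∧
    (ω ∈ SymmDiff.iso k R' (rowIcc (k + 1) (k + R')) → ω ∈ SymmDiff.iso k R (rowIcc (k + 1) (k + R)))
  exact ⟨iso_anti hω k hRR' (rowIcc_left_mono k hRR'), iso_anti hω k hRR' (rowIcc_right_mono k hRR')⟩

end TwoArmLower

end Summit.CriticalPhenomena.CardyFormulaZ2.Cruxes.HalfPlaneMarkDensityLaw.SketchLine
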